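import Summits.Ventures.QEC.Census.CertCheckMitmFast
import Summits.Ventures.QEC.Census.CertChunks2F
import HarnessLib

/-!
# Generic KERNEL meet-in-the-middle lane: depth-safe table builder, representative (non-injective) tables,
# chunked probes and table parts (item 07.MITMK, qec-type-07; CERT-FORMAT v1 §5.2 / §4 L4)

`CertCheckMitm.lean` (qec-search-9) replays the meet-in-the-middle lower bound against a SHIPPED syndrome table;
`CertCheckMitmFast.lean` (qec-search-7) builds the table IN THE KERNEL by nested inserts and runs ONE `decide +kernel`
per side. Limits of that lane (qec-search-7, STATUS 2026-08-27T02:29:27Z): (i) its test (T1) needs pairwise DISTINCT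
tabled syndromes — impossible once the code has a zero-syndrome word of weight `≤ 2·wb` (light stabilizers:
hypergraph products, hyperbicycle codes, weight-5 lifted products, any `wb ≥ w_stab/2`); (ii) the nested build is
evaluated `N` frames deep and trips the kernel recursion guard at `N = 10 441` (`n = 144`, `wb = 2`); (iii) one
evaluation per side caps the probe count (≈ 2·10⁵ lookups per `decide +kernel` at the default budget). Here:

* §1 **depth-safe builder** `buildTabQ L kb wb i0 len` / lookup `tabFindQ`: end points COLLECTED lazily
  (`collectF`, accumulator-passing on primitive recursors), keys mixed (`mixKey`, a bijection on `kb`-bit syndromes),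
  quicksort-tree `qsTree` (head pivot, strict splits ⇒ ONE representative per syndrome, recursion depth = tree depth,
  fuel 255); `i0, len` select a TABLE PART = the patterns whose first position lies in `[i0, i0 + len)` plus the empty
  pattern, so a large table is split over several evaluations. Measured (farm): `n = 144`, `wb = 2`: 10 441 entries
  built + self-checked in ≈ 15 s, depth 33; probes ≈ 0.7 ms each.
* §2 **representative tests** against an ARBITRARY lookup `f : ℕ → Option ℕ`: (T1ᴿ) `tableTestR` — pattern `B`
  finds `b₀ = f (syn B)` with `word B ⊕ b₀ ∈ {0} ∪ allow`; (T3ᴿ) `probeTestR` — pattern `A` finds nothing, or `b₀`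
  with `word A ⊕ b₀ ∈ {0} ∪ allow` (no weight escape).
* §3 **soundness** (`mitmR_pair` → `mitmR_cover_sound` → `mitmK_lower_sound`): for a zero-syndrome selection
  `S = A ++ B` both halves meet the same `b₀`, so `word S = (word A ⊕ b₀) ⊕ (word B ⊕ b₀)` is a sum of two words
  each `0` or allow-listed, hence (decompositions checked by `foundOK`) in the stabilizer row space. NOTHING about the
  builder is used. The table side is the `Prop` twin `ReachesP` of `Reaches` with predicate `CoverP allow pos wa` =
  «filed in SOME table whose probes all pass», so parts may differ per pattern; assembling lemmas
  `reachesP_of_chunks` / `reachesP_origin_of_chunk1` / `forall_coverP_of_chunk1R(F)` mirror `CertChunks`, the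
  probe side being `Reaches (probeTestR f allow) (posList n H) wa 0 0` from `chunk1R`/`chunk2R` leaves verbatim.
  Completeness (when the checks CAN pass): `2·wb ≤ wmax` and the allow-list holds every stabilizer word of weight
  `≤ wmax` — so the table is the smaller half, `wb = ⌊wmax/2⌋`.
* §4 `DistCert.MitmKZ/MitmKX` and `dZ_code_of_mitmK(')` / `dX_code_of_mitmK(')` (allow-list = the certificate's
  `found`, or any external list passing `foundOK`) conclude `(c.code _).dZ = c.dZ` like `dZ_code_of_mitm`.
Controls (CERT-REQS A1): `Census/CertMitmKControls.lean` (`[[4,2,2]]`; Shor `[[9,1,3]]` with three qubits per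
syndrome, where the injective lane provably rejects; two table parts; the `2·wb > wmax` boundary).
Emitter: HOME/census/type-07/emit_mitmk.py (python replicas of §1–§2 run before any farm second).
Generic; axioms ⊆ {propext, Classical.choice, Quot.sound}; no `native_decide`.
-/

namespace Summit.Ventures.QEC.Census

open Matrix Literature.InformationTheory.QuantumCodes

/-! ## §1 The depth-safe in-kernel table builder -/

/-- `collectF L b v s acc`: every end point of the include/skip enumeration (discipline of `scan` / `scanF`) of the
sub-selections of `≤ b` positions of `L` from `(v, s)`, recorded as `(syndrome, word)` and consed onto `acc`;
accumulator-passing on primitive recursors, so the list is produced lazily in shallow kernel steps. (definition) -/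
noncomputable def collectF (L : List (ℕ × ℕ)) : ℕ → ℕ → ℕ → List (ℕ × ℕ) → List (ℕ × ℕ) :=
  List.rec (motive := fun _ => ℕ → ℕ → ℕ → List (ℕ × ℕ) → List (ℕ × ℕ)) (fun _ v s acc => (s, v) :: acc)
    (fun pc _ ih b v s acc =>
      Nat.rec (motive := fun _ => List (ℕ × ℕ)) ((s, v) :: acc)
        (fun b' _ => ih (Nat.succ b') v s (ih b' (Nat.xor v pc.1) (Nat.xor s pc.2) acc)) b)
    L

/-- The entries of `l` with key strictly below `k` (primitive recursor, lazy). (definition) -/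
noncomputable def keysBelow (k : ℕ) (l : List (ℕ × ℕ)) : List (ℕ × ℕ) :=
  List.rec (motive := fun _ => List (ℕ × ℕ)) [] (fun e _ ih => cond (Nat.blt e.1 k) (e :: ih) ih) l

/-- The entries of `l` with key strictly above `k` (primitive recursor, lazy). (definition) -/
noncomputable def keysAbove (k : ℕ) (l : List (ℕ × ℕ)) : List (ℕ × ℕ) :=
  List.rec (motive := fun _ => List (ℕ × ℕ)) [] (fun e _ ih => cond (Nat.blt k e.1) (e :: ih) ih) l

/-- Quicksort-tree of a `(key, value)` list: the head is the node, strictly smaller keys go left, strictly larger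
keys go right (so equal keys after the first are DROPPED: one representative per key), recursively with `fuel`
levels (an exhausted level is a `leaf`; losing entries can only make a check fail, never pass). Recursion depth =
tree depth. (definition) -/
noncomputable def qsTree (fuel : ℕ) : List (ℕ × ℕ) → SynTree :=
  Nat.rec (motive := fun _ => List (ℕ × ℕ) → SynTree) (fun _ => SynTree.leaf)
    (fun _ ih l => List.rec (motive := fun _ => SynTree) SynTree.leaf
      (fun e rest _ => SynTree.node (ih (keysBelow e.1 rest)) e.1 e.2 (ih (keysAbove e.1 rest))) l) fuel

/-- Key mixing: multiply by a fixed odd 64-bit constant and keep `kb` bits — a bijection on `kb`-bit syndromes that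
spreads the (highly structured) syndromes of a census code, so that the head-pivot quicksort-tree stays shallow
(measured: depth 73 → 33 at `N = 10 441`, `n = 144`). Used on insertion AND lookup; soundness never looks at it.
(definition) -/
def mixKey (kb s : ℕ) : ℕ := s * 11400714819323198485 % 2 ^ kb

/-- Mix the keys of an entry list (primitive recursor, lazy). (definition) -/
noncomputable def mixEntries (kb : ℕ) (l : List (ℕ × ℕ)) : List (ℕ × ℕ) :=
  List.rec (motive := fun _ => List (ℕ × ℕ)) [] (fun e _ ih => (mixKey kb e.1, e.2) :: ih) l

/-- The entries of the TABLE PART `[i0, i0 + len)`: for each first position `i` in the range, the patterns made of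
position `i` and at most `b` LATER positions of `L` (= the level-1 chunks `i` of the enumeration of budget `b + 1`),
consed in order onto `acc`. (definition) -/
noncomputable def collectParts (L : List (ℕ × ℕ)) (b i0 len : ℕ) (acc : List (ℕ × ℕ)) : List (ℕ × ℕ) :=
  (List.range' i0 len).foldr (fun i r => collectF (L.drop (i + 1)) b (L.getD i (0, 0)).1 (L.getD i (0, 0)).2 r) acc

/-- The entries of table part `[i0, i0 + len)` at budget `wb`: the EMPTY pattern `(0 ↦ 0)` first, then (if `wb ≥ 1`)
every pattern of weight `1 … wb` whose first position lies in the range; the full table is the part `[0, |L|)`. -/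
noncomputable def tabEntries (L : List (ℕ × ℕ)) (wb i0 len : ℕ) : List (ℕ × ℕ) :=
  (0, 0) :: Nat.rec (motive := fun _ => List (ℕ × ℕ)) [] (fun b' _ => collectParts L b' i0 len []) wb

/-- **The depth-safe kernel-built table** (part `[i0, i0 + len)`, budget `wb`, keys mixed at `kb` bits) over the
position list `L`: quicksort-tree of the key-mixed `tabEntries`, fuel `255`. (definition) -/
noncomputable def buildTabQ (L : List (ℕ × ℕ)) (kb wb i0 len : ℕ) : SynTree :=
  qsTree 255 (mixEntries kb (tabEntries L wb i0 len))

/-- **The lookup function of a kernel-built table part** (the shape the emitted files use): syndrome `s ↦` the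
representative word filed under `mixKey kb s`; the table term is shared by all lookups of one kernel evaluation. -/
noncomputable def tabFindQ (L : List (ℕ × ℕ)) (kb wb i0 len : ℕ) (s : ℕ) : Option ℕ :=
  (buildTabQ L kb wb i0 len).find (mixKey kb s)

/-! ## §2 The representative leaf tests -/

/-- Self-lookup outcome of a tabled word `v`: `none` FAILS; `some b₀` passes iff `v ⊕ b₀ ∈ {0} ∪ allow`. -/
def repRes (allow : List ℕ) (v : ℕ) : Option ℕ → Bool
  | none => false
  | some b => (v ^^^ b == 0) || allow.elem (v ^^^ b)

/-- Probe outcome of a word `v`: `none` passes; `some b₀` passes iff `v ⊕ b₀ ∈ {0} ∪ allow` (no weight escape). -/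
def probeResR (allow : List ℕ) (v : ℕ) : Option ℕ → Bool
  | none => true
  | some b => (v ^^^ b == 0) || allow.elem (v ^^^ b)

/-- **(T1ᴿ)** leaf test of the table side against a lookup function `f` (syndrome `↦` representative word; in the
emitted files `f = tabFindQ …`, but ANY function is allowed): the pattern with word `v` and syndrome `s` finds a
representative `b₀ = f s` with `v ⊕ b₀ ∈ {0} ∪ allow`. (definition) -/
def tableTestR (f : ℕ → Option ℕ) (allow : List ℕ) (v s : ℕ) : Bool := repRes allow v (f s)

/-- **(T3ᴿ)** leaf test of the probe side: the pattern with word `v` and syndrome `s` finds nothing under `s`, or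
`b₀ = f s` with `v ⊕ b₀ ∈ {0} ∪ allow`. (definition) -/
def probeTestR (f : ℕ → Option ℕ) (allow : List ℕ) (v s : ℕ) : Bool := probeResR allow v (f s)

/-- `mixKey kb 0 = 0`: the empty pattern keeps key `0`. -/
theorem mixKey_zero (kb : ℕ) : mixKey kb 0 = 0 := by simp [mixKey]

/-- The empty pattern `(0 ↦ 0)` heads `tabEntries`, so it is the ROOT of every kernel-built table part and the
lookup of syndrome `0` returns the word `0` (definitional unfolding; no other property of the builder is ever used). -/
theorem tabFindQ_zero (L : List (ℕ × ℕ)) (kb wb i0 len : ℕ) : tabFindQ L kb wb i0 len 0 = some 0 := by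
  rw [tabFindQ, mixKey_zero]
  show SynTree.find 0 (qsTree (254 + 1) ((mixKey kb 0, 0) :: _)) = some 0
  rw [mixKey_zero]
  rfl

/-- Hence the origin passes (T1ᴿ) against every kernel-built table part (the `h0` of the assembling lemma
`reachesP_origin_of_chunk1`, with no kernel evaluation). -/
theorem tableTestR_tabFindQ_origin (L : List (ℕ × ℕ)) (kb wb i0 len : ℕ) (allow : List ℕ) :
    tableTestR (tabFindQ L kb wb i0 len) allow 0 0 = true := by
  rw [tableTestR, tabFindQ_zero]
  rfl

/-! ## §3 Soundness -/

section Soundness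

/-- «`x` is `0` or allow-listed». -/
def OkWord (allow : List ℕ) (x : ℕ) : Prop := x = 0 ∨ allow.elem x = true

/-- Unpacking a passing self-lookup. -/
theorem repRes_true {allow : List ℕ} {v : ℕ} {o : Option ℕ} (h : repRes allow v o = true) :
    ∃ b, o = some b ∧ OkWord allow (v ^^^ b) := by
  cases o with
  | none => simp [repRes] at h
  | some b =>
    refine ⟨b, rfl, ?_⟩
    simpa [repRes, OkWord, Bool.or_eq_true, beq_iff_eq] using h

/-- Unpacking a passing probe that met `some b`. -/
theorem probeResR_some {allow : List ℕ} {v b : ℕ} (h : probeResR allow v (some b) = true) :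
    OkWord allow (v ^^^ b) := by
  simpa [probeResR, OkWord, Bool.or_eq_true, beq_iff_eq] using h

/-- **L4ᴿ for one pair.** If the pattern `B` passes (T1ᴿ) and the pattern `A` passes (T3ᴿ) against the same
table and `syn A = syn B`, then `word (A ++ B) = x ⊕ y` with `x`, `y` each `0` or allow-listed. -/
theorem mitmR_pair {f : ℕ → Option ℕ} {allow : List ℕ} {A B : List (ℕ × ℕ)}
    (hB : tableTestR f allow (xorFst B) (xorSnd B) = true) (hA : probeTestR f allow (xorFst A) (xorSnd A) = true)
    (hsyn : xorSnd A = xorSnd B) :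
    ∃ x y, xorFst (A ++ B) = x ^^^ y ∧ OkWord allow x ∧ OkWord allow y := by
  obtain ⟨b, hb, hBok⟩ := repRes_true hB
  rw [probeTestR, hsyn, hb] at hA
  refine ⟨xorFst A ^^^ b, xorFst B ^^^ b, ?_, probeResR_some hA, hBok⟩
  rw [xorFst_append, Nat.xor_assoc, ← Nat.xor_assoc b, Nat.xor_comm b, Nat.xor_assoc, Nat.xor_self, Nat.xor_zero]

/-- `ReachesP P L b v s`: the `Prop`-valued twin of `Reaches` — `P` holds at `(v ⊕ xorFst S, s ⊕ xorSnd S)` for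
every sublist `S` of `L` of length `≤ b`. -/
def ReachesP (P : ℕ → ℕ → Prop) (L : List (ℕ × ℕ)) (b v s : ℕ) : Prop :=
  ∀ S : List (ℕ × ℕ), S.Sublist L → S.length ≤ b → P (v ^^^ xorFst S) (s ^^^ xorSnd S)

/-- **Chunking by the first selected position**, `Prop` version of `CertScan.reaches_of_chunks`. -/
theorem reachesP_of_chunks {P : ℕ → ℕ → Prop} :
    ∀ (L : List (ℕ × ℕ)) (b v s : ℕ), P v s →
      (∀ (i : ℕ) (hi : i < L.length), ReachesP P (L.drop (i + 1)) b (v ^^^ (L[i]).1) (s ^^^ (L[i]).2)) →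
      ReachesP P L (b + 1) v s := by
  intro L
  induction L with
  | nil =>
    intro b v s h0 _ S hS _
    rw [List.sublist_nil.mp hS]
    simpa [xorFst, xorSnd, xorList] using h0
  | cons a L ih =>
    intro b v s h0 hch S hS hlen
    rcases hS with _ | ⟨_, hS'⟩ | ⟨_, hS'⟩
    · refine ih b v s h0 (fun i hi => ?_) S hS' hlen
      have hi' : i + 1 < (a :: L).length := by simpa using hi
      have := hch (i + 1) hi'
      simpa using this
    · rename_i S'
      have hlen' : S'.length ≤ b := by simpa using hlen
      have h0' : 0 < (a :: L).length := by simp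
      have := hch 0 h0' S' hS' hlen'
      rw [xorFst_cons, xorSnd_cons]
      simpa [Nat.xor_assoc] using this

/-- In range, `getD` is `getElem`. -/
private theorem getD_eq_getElem_of_lt {α : Type*} (l : List α) (d : α) {k : ℕ} (hk : k < l.length) :
    l.getD k d = l[k] := by rw [List.getD_eq_getElem?_getD, List.getElem?_eq_getElem hk, Option.getD_some]

/-- **Level 1 ⇒ the whole enumeration**, `Prop` version of `CertChunks.reaches_origin_of_chunk1`: `P` at the origin
and every level-1 chunk `i < |L| = n` with budget `b` give `ReachesP P L (b + 1) 0 0`. -/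
theorem reachesP_origin_of_chunk1 {P : ℕ → ℕ → Prop} {L : List (ℕ × ℕ)} {b : ℕ} (n : ℕ) (hn : L.length = n)
    (h0 : P 0 0) (h : ∀ i, i < n → ReachesP P (L.drop (i + 1)) b (L.getD i (0, 0)).1 (L.getD i (0, 0)).2) :
    ReachesP P L (b + 1) 0 0 := by
  refine reachesP_of_chunks L b 0 0 h0 fun i hi => ?_
  have hc := h i (hn ▸ hi)
  rwa [getD_eq_getElem_of_lt _ _ hi, ← Nat.zero_xor (L[i]).1, ← Nat.zero_xor (L[i]).2] at hc

/-- `CoverP allow pos wa v s`: the pattern with word `v` and syndrome `s` is filed — passes (T1ᴿ) — in SOME table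
(lookup function) against which EVERY probe (sub-selection of `pos` of `≤ wa` positions, from the origin) passes
(T3ᴿ). Different patterns may name different tables (table parts). -/
def CoverP (allow : List ℕ) (pos : List (ℕ × ℕ)) (wa : ℕ) (v s : ℕ) : Prop :=
  ∃ f : ℕ → Option ℕ, tableTestR f allow v s = true ∧ Reaches (probeTestR f allow) pos wa 0 0

/-- One table for a whole stretch: (T1ᴿ) reached over `L` from `(v, s)` with budget `b` and all probes passing
against the same `T` give the cover property there. -/
theorem reachesP_coverP_of_reaches {f : ℕ → Option ℕ} {allow : List ℕ} {pos L : List (ℕ × ℕ)} {wa b v s : ℕ}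
    (hT1 : Reaches (tableTestR f allow) L b v s) (hT3 : Reaches (probeTestR f allow) pos wa 0 0) :
    ReachesP (CoverP allow pos wa) L b v s :=
  fun S hS hlen => ⟨f, hT1 S hS hlen, hT3⟩

/-- The origin (empty pattern) is covered by any table in which it passes (T1ᴿ) and whose probes pass. -/
theorem coverP_origin {allow : List ℕ} {pos : List (ℕ × ℕ)} {wa : ℕ} (f : ℕ → Option ℕ)
    (h0 : tableTestR f allow 0 0 = true) (hT3 : Reaches (probeTestR f allow) pos wa 0 0) :
    CoverP allow pos wa 0 0 :=
  ⟨f, h0, hT3⟩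

/-- **Table-part assembly**: a passing packed range of level-1 chunks of the (T1ᴿ) enumeration against a table
part `T` (`chunk1R (tableTestR T allow) L b i0 len`) whose probes all pass covers every pattern whose first
position is in `[i0, i0 + len)` (with `≤ b` further positions). -/
theorem forall_coverP_of_chunk1R {f : ℕ → Option ℕ} {allow : List ℕ} {pos L : List (ℕ × ℕ)} {wa b i0 len : ℕ}
    (h : chunk1R (tableTestR f allow) L b i0 len = true) (hT3 : Reaches (probeTestR f allow) pos wa 0 0) :
    ∀ i, i0 ≤ i → i < i0 + len →
      ReachesP (CoverP allow pos wa) (L.drop (i + 1)) b (L.getD i (0, 0)).1 (L.getD i (0, 0)).2 :=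
  fun i ha hi => reachesP_coverP_of_reaches (forall_of_chunk1R h i ha hi) hT3

/-- The same from the FAST packed range `chunk1RF`. -/
theorem forall_coverP_of_chunk1RF {f : ℕ → Option ℕ} {allow : List ℕ} {pos L : List (ℕ × ℕ)} {wa b i0 len : ℕ}
    (h : chunk1RF (tableTestR f allow) L b i0 len = true) (hT3 : Reaches (probeTestR f allow) pos wa 0 0) :
    ∀ i, i0 ≤ i → i < i0 + len →
      ReachesP (CoverP allow pos wa) (L.drop (i + 1)) b (L.getD i (0, 0)).1 (L.getD i (0, 0)).2 :=
  forall_coverP_of_chunk1R ((chunk1RF_eq _ _ _ _ _).symm.trans h) hT3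

/-- **L4ᴿ at the word level**: if every sub-selection `B` of `pos` with `|B| ≤ wb` is covered, then every
sub-selection `S` of `pos` with `|S| ≤ wa + wb` and zero syndrome has `word S = x ⊕ y` with `x`, `y` each `0` or
allow-listed. Proof: `S = A ++ B`, `A = S.take wa`, `B = S.drop wa`; `B` is filed in some `f` as `b₀` up to an
allowed word; `syn A = syn B`; the probe of `A` against that `f` meets `b₀`; `mitmR_pair`. -/
theorem mitmR_cover_sound {allow : List ℕ} {pos : List (ℕ × ℕ)} {wa wb : ℕ}
    (hcov : ReachesP (CoverP allow pos wa) pos wb 0 0) (S : List (ℕ × ℕ)) (hS : S.Sublist pos)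
    (hlen : S.length ≤ wa + wb) (hsyn : xorSnd S = 0) :
    ∃ x y, xorFst S = x ^^^ y ∧ OkWord allow x ∧ OkWord allow y := by
  set A := S.take wa with hA
  set B := S.drop wa with hB
  have hAB : A ++ B = S := List.take_append_drop wa S
  have hAsub : A.Sublist pos := (List.take_sublist wa S).trans hS
  have hBsub : B.Sublist pos := (List.drop_sublist wa S).trans hS
  have hAlen : A.length ≤ wa := by rw [hA, List.length_take]; exact Nat.min_le_left _ _
  have hBlen : B.length ≤ wb := by rw [hB, List.length_drop]; omega
  obtain ⟨f, hT1, hT3⟩ := hcov B hBsub hBlen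
  rw [Nat.zero_xor, Nat.zero_xor] at hT1
  have h3 := hT3 A hAsub hAlen
  rw [Nat.zero_xor, Nat.zero_xor] at h3
  have hsAB : xorSnd A = xorSnd B := by
    have h0 : xorSnd A ^^^ xorSnd B = 0 := by rw [← xorSnd_append, hAB, hsyn]
    have h2 : xorSnd A ^^^ (xorSnd A ^^^ xorSnd B) = xorSnd A := by rw [h0, Nat.xor_zero]
    rwa [← Nat.xor_assoc, Nat.xor_self, Nat.zero_xor, eq_comm] at h2
  rw [← hAB]
  exact mitmR_pair hT1 h3 hsAB

variable {n : ℕ} {Hsyn Hstab : List ℕ}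

/-- A word that is `0` or on a decomposed allow-list is in the stabilizer row space. -/
theorem ofBits_mem_rowSpace_of_okWord {found : List (ℕ × List ℕ)} (hfound : foundOK Hstab found = true) {x : ℕ}
    (hx : OkWord (found.map Prod.fst) x) : ofBits n x ∈ rowSpace (rowMatrix n Hstab) := by
  simp only [foundOK, List.all_eq_true, beq_iff_eq] at hfound
  rcases hx with h0 | hmem
  · rw [h0, ofBits_zero]
    exact Submodule.zero_mem _
  · obtain ⟨e, he, hex⟩ : ∃ e ∈ found, e.1 = x := by
      simpa [List.mem_map] using List.mem_of_elem_eq_true hmem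
    rw [← hex, ← hfound e he]
    exact ofBits_xorRows_mem_rowSpace n Hstab e.2

/-- **Lower bound from the generic meet-in-the-middle replay** (conclusion of `CertCheck.lower_sound` /
`CertCheckMitm.mitm_lower_sound`): if the allow-list decomposes over the stabilizer rows and every pattern of
`≤ wb` positions is covered (filed in a table part whose probes of `≤ wa` positions all pass), then every logical
operator — zero `Hsyn`-syndrome, outside the `Hstab` row space — has weight `> wa + wb`. -/
theorem mitmK_lower_sound {wa wb : ℕ} {found : List (ℕ × List ℕ)} (hfound : foundOK Hstab found = true)
    (hcov : ReachesP (CoverP (found.map Prod.fst) (posList n Hsyn) wa) (posList n Hsyn) wb 0 0)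
    (w : Fin n → ZMod 2) (hw : rowMatrix n Hsyn *ᵥ w = 0) (hw' : w ∉ rowSpace (rowMatrix n Hstab)) :
    wa + wb < hammingNorm w := by
  by_contra hle
  rw [not_lt] at hle
  have hlen : (suppList n Hsyn w).length ≤ wa + wb := by rw [length_suppList]; exact hle
  obtain ⟨x, y, hxy, hx, hy⟩ := mitmR_cover_sound hcov (suppList n Hsyn w) (suppList_sublist n Hsyn w) hlen
    (xorSnd_suppList_eq_zero n Hsyn w hw)
  apply hw'
  rw [← ofBits_xorFst_suppList n Hsyn w, hxy, ofBits_xor]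
  exact Submodule.add_mem _ (ofBits_mem_rowSpace_of_okWord hfound hx) (ofBits_mem_rowSpace_of_okWord hfound hy)

/-- Soundness of one side in the form of type-02's `CSSCode.dX_eq_of_witness` (witness + universal lower bound), as
`side_sound_of_mitm` does for the shipped-table replay; the allow-list `found` may be the side's own or any other
decomposed list. -/
theorem side_sound_of_mitmK {s : SideCert} {wa wb : ℕ} {found : List (ℕ × List ℕ)}
    (hup : upperOK n Hsyn Hstab s.d s.witness s.nonmember = true) (hfound : foundOK Hstab found = true)
    (hd : s.d = wa + wb + 1)
    (hcov : ReachesP (CoverP (found.map Prod.fst) (posList n Hsyn) wa) (posList n Hsyn) wb 0 0) :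
    ∃ v : Fin n → ZMod 2, rowMatrix n Hsyn *ᵥ v = 0 ∧ v ∉ rowSpace (rowMatrix n Hstab) ∧ hammingNorm v = s.d ∧
      ∀ w : Fin n → ZMod 2, rowMatrix n Hsyn *ᵥ w = 0 → w ∉ rowSpace (rowMatrix n Hstab) →
        s.d ≤ hammingNorm w := by
  obtain ⟨hv, hv', hwt⟩ := upper_sound hup
  refine ⟨ofBits n s.witness, hv, hv', hwt, fun w hw hw' => ?_⟩
  have := mitmK_lower_sound hfound hcov w hw hw'
  omega

end Soundness

/-! ## §4 The certificate-level statements -/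

namespace DistCert

variable (c : DistCert)

/-- **The `Z`-side obligation of the generic mitm lane**: against the allow-list `allow`, every `Z`-pattern of
`≤ wb` qubits (positions of `posList n HX`) is covered — filed in some kernel-built table part against which every
probe of `≤ wa` qubits passes. Established by the emitted files (T1ᴿ chunks per table part + T3ᴿ probe chunks) and
the assembling lemmas of §3. -/
def MitmKZ (allow : List ℕ) (wa wb : ℕ) : Prop :=
  ReachesP (CoverP allow (posList c.n c.HX) wa) (posList c.n c.HX) wb 0 0

/-- **The `X`-side obligation** (roles exchanged: positions of `posList n HZ`). -/
def MitmKX (allow : List ℕ) (wa wb : ℕ) : Prop :=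
  ReachesP (CoverP allow (posList c.n c.HZ) wa) (posList c.n c.HZ) wb 0 0

/-- One table for the whole `Z` side: (T1ᴿ) reached with budget `wb` and (T3ᴿ) reached with budget `wa`, both from
the origin, give `MitmKZ`. -/
theorem mitmKZ_of_reaches {allow : List ℕ} {wa wb : ℕ} {f : ℕ → Option ℕ}
    (hT1 : Reaches (tableTestR f allow) (posList c.n c.HX) wb 0 0)
    (hT3 : Reaches (probeTestR f allow) (posList c.n c.HX) wa 0 0) : c.MitmKZ allow wa wb :=
  reachesP_coverP_of_reaches hT1 hT3

/-- One table for the whole `X` side. -/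
theorem mitmKX_of_reaches {allow : List ℕ} {wa wb : ℕ} {f : ℕ → Option ℕ}
    (hT1 : Reaches (tableTestR f allow) (posList c.n c.HZ) wb 0 0)
    (hT3 : Reaches (probeTestR f allow) (posList c.n c.HZ) wa 0 0) : c.MitmKX allow wa wb :=
  reachesP_coverP_of_reaches hT1 hT3

/-- **Soundness, `Z` side** (allow-list = the certificate's own `sideZ.found`, checked inside `checkStructure`):
the structural check, `dZ = wa + wb + 1` and `MitmKZ` give `Z`-distance `c.dZ`. (theorem) -/
theorem dZ_code_of_mitmK {wa wb : ℕ} (hs : c.checkStructure = true) (hd : c.dZ = wa + wb + 1)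
    (hZ : c.MitmKZ (c.sideZ.found.map Prod.fst) wa wb) : (c.code (c.commOK_of_checkStructure hs)).dZ = c.dZ := by
  have h' := hs
  simp only [checkStructure, Bool.and_eq_true] at h'
  obtain ⟨v, hv, hv', hwt, hall⟩ := side_sound_of_mitmK (s := c.sideZ) h'.1.1.1.2 h'.1.1.2 hd hZ
  exact (c.code _).dZ_eq_of_witness hv hv' hwt hall

/-- **Soundness, `X` side** (allow-list = `sideX.found`). (theorem) -/
theorem dX_code_of_mitmK {wa wb : ℕ} (hs : c.checkStructure = true) (hd : c.dX = wa + wb + 1)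
    (hX : c.MitmKX (c.sideX.found.map Prod.fst) wa wb) : (c.code (c.commOK_of_checkStructure hs)).dX = c.dX := by
  have h' := hs
  simp only [checkStructure, Bool.and_eq_true] at h'
  obtain ⟨v, hv, hv', hwt, hall⟩ := side_sound_of_mitmK (s := c.sideX) h'.1.2 h'.2 hd hX
  exact (c.code _).dX_eq_of_witness hv hv' hwt hall

/-- **Soundness, `Z` side, external allow-list**: any list `found'` of (word, `HZ`-row decomposition) pairs passing
`foundOK c.HZ found'` may serve as the allow-list (e.g. ALL stabilizer words of weight `≤ dZ − 1` when the
certificate's own `found` is a `bz`-method excerpt). (theorem) -/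
theorem dZ_code_of_mitmK' {wa wb : ℕ} {found' : List (ℕ × List ℕ)} (hs : c.checkStructure = true)
    (hfound : foundOK c.HZ found' = true) (hd : c.dZ = wa + wb + 1) (hZ : c.MitmKZ (found'.map Prod.fst) wa wb) :
    (c.code (c.commOK_of_checkStructure hs)).dZ = c.dZ := by
  have h' := hs
  simp only [checkStructure, Bool.and_eq_true] at h'
  obtain ⟨v, hv, hv', hwt, hall⟩ := side_sound_of_mitmK (s := c.sideZ) h'.1.1.1.2 hfound hd hZ
  exact (c.code _).dZ_eq_of_witness hv hv' hwt hall

/-- **Soundness, `X` side, external allow-list** (decompositions over `HX`). (theorem) -/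
theorem dX_code_of_mitmK' {wa wb : ℕ} {found' : List (ℕ × List ℕ)} (hs : c.checkStructure = true)
    (hfound : foundOK c.HX found' = true) (hd : c.dX = wa + wb + 1) (hX : c.MitmKX (found'.map Prod.fst) wa wb) :
    (c.code (c.commOK_of_checkStructure hs)).dX = c.dX := by
  have h' := hs
  simp only [checkStructure, Bool.and_eq_true] at h'
  obtain ⟨v, hv, hv', hwt, hall⟩ := side_sound_of_mitmK (s := c.sideX) h'.1.2 hfound hd hX
  exact (c.code _).dX_eq_of_witness hv hv' hwt hall

end DistCert

end Summit.Ventures.QEC.Census
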